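import Summits.QuantumFields.BalabanUV.T4Continuum.Support.ShellMeasureBlockWiringCube
import Summits.QuantumFields.BalabanUV.T4Continuum.Support.ShellMeasureLandauExponent
import Summits.QuantumFields.BalabanUV.T4Continuum.Support.ShellMeasureLandauFixedPoint

/-!
# `T4Continuum.ShellMeasureBlockWiringLandau` — the S22 → S4 junctions: END-II's `hAN` for a block from the Landau
# exponent, on both roads (Fréchet `Ψ = id − H∘D` through S4 file 3; the kernel correction `D` along the rays through
# S4 file 1)
# (cell `pub-balaban`, sub-cell `t4`, spine estimate NE7c (node U5b); NE7c formalisation swarm, crew seat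
# `b2b-balaban-t4-ne7c-formalise-leaf-02` gen 2, OFFERED row S22 file 5; imports S4 file 3 `ShellMeasureBlockWiringCube`
# (leaf-07, p209083) and this row's files 1–2; 0 `def`, 0 sorry)

HONEST FRAMING.  Finite four-torus programme, rung (B)+1 only — NOT infinite volume, NOT a mass gap, NOT the Clay
problem, NOT summit progress; (B), `BetaPertHyp`, (B^μ) not consumed.  NE7c (`T4IndicatorShell.ShellWeightBound`) is
NOT PRINTED and NOT PROVED; «NE7c ⇐ the named binders».  Row S4 (leaf-07) wires END-II's SM-L1 binder `hAN` for a whole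
block from PER-BOND analytic data (`ShellMeasureBlockWiring.hAN_of_blockBondData`: bond functions `X x b` holomorphic on
`ball 0 R`, `‖X‖ ≤ a`, `X x b 0 = 0`, holonomy = the four oriented bond exponentials ⟹ `hAN` with `H = e^{4a} − 1`),
and its file 3 threads an ABSTRACT Landau map `Ψ` through the read-outs (`ShellMeasureBlockWiringCube.hAN_of_readOuts`,
binder (Ψ-an) in Fréchet form, per this lineage's FINDING F-ne7cleaf02-1).  Row S22 (this seat) SUPPLIES the Landau
data; this file is the two one-call junctions, so that both S22 roads end LITERALLY in E2′'s `hAN` binder for a block: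
* §1 ROAD 1 (Fréchet): `hAN_of_readOuts_linearization` = `hAN_of_readOuts` with (Ψ-an) DISCHARGED by file 1's
  `ShellMeasureLandauExponent.landau_binders` — `Ψ := fun Y => Y − H (D Y)` from `hH : ‖H B‖ ≤ B₀‖B‖` ((46) TYPE) and
  `hDd`/`hD` ((55) + Prop. 3 TYPE on `ball 0 (ε₄ + a)`); `H_AN = e^{4κ((ε₄+a) + B₀C_D(ε₄+a)²)} − 1`.
* §2 ROAD 2 (kernel `D`): `hAN_of_landauRays` = `hAN_of_blockBondData` on the bond family
  `X x b σ := ℓ_b (Y_x σ − H (D_x σ))`, where per window point `x` the curve `Y_x` (‖·‖ < ε, flat at 0) and the Landau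
  correction `D_x` (holomorphic, `‖D_x σ‖ ≤ 4C₂ε²`, `D_x 0 = 0`) are the OUTPUT of file 2's
  `ShellMeasureLandauFixedPoint.landauCorrection_along` / `landauCorrection_zero` (destructured by the instantiator —
  they are ∃-statements with uniqueness), (an)+(fl) per bond by file 2's `bondFn_landau_along`;
  `H_AN = e^{4κ(ε + 4C₂B₀ε²)} − 1`.
WHAT REMAINS LOCATED is the union of S4's and S22's lists (per-bond read-outs `ℓ_b` = (115)/(77) definition; the
four-letter holonomy dictionary at a flat centre (G-ne7cp1-11/13a); (P2)/(P4)/Prop. 6 smallness; (44)/(46)/(54) resp.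
(46)/(55); ray data (75)/(103)/[6] (1.31)).  Nothing of the audited series is discharged.  0 sorry, 0 `def`.  HONEST
DEPENDENCY (cell): continuum YM on T⁴ ⇐ BetaPertH ∧ nine spine estimates (0/9 proved); BetaPertH ⇐ (D1) ∧ (D4) ∧
CAP+tail; G-an2-4 gates asym, D1 and NE2/3/4.
-/

noncomputable section

open Set Metric NormedSpace

namespace Summit.QuantumFields.BalabanUV.T4Continuum.ShellMeasureBlockWiringLandau

open Literature.MathematicalPhysics.QuantumFieldTheory.Balaban1983to89
open ShellMeasureBlockWiring (plaqOBonds hAN_of_blockBondData hAN_of_readOuts)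
open ShellMeasureLandauExponent (landau_binders)
open ShellMeasureLandauFixedPoint (bondFn_landau_along)

variable {P : Params} {j : ℕ} {E : Type*} [AddCommGroup E] [Module ℝ E]
variable {𝒴 𝒟 𝒳 : Type*} [NormedAddCommGroup 𝒴] [NormedSpace ℂ 𝒴] [NormedAddCommGroup 𝒟] [NormedSpace ℂ 𝒟]
  [NormedAddCommGroup 𝒳] [NormedSpace ℂ 𝒳]
variable {A : Type*} [NormedRing A] [NormedAlgebra ℂ A] [CompleteSpace A]

/-! ## §1 Road 1: S4 file 3's `hAN_of_readOuts` with (Ψ-an) from the linearization data -/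

omit [NormedAddCommGroup 𝒳] [NormedSpace ℂ 𝒳] in
/-- **END-II's `hAN` FOR A BLOCK, ROAD 1** — `ShellMeasureBlockWiringCube.hAN_of_readOuts` (leaf-07) with its (Ψ-an)
binders `hΨd`/`hΨ0`/`hΨb` DISCHARGED by `ShellMeasureLandauExponent.landau_binders` for `Ψ := fun Y => Y − H (D Y)`:
remaining Landau data = `hH` ((46) TYPE), `hDd`/`hD` ((55) + Prop. 3 TYPE on the ball `‖Y‖ < ε₄ + a`).
`H_AN = e^{4κψ̄} − 1`, `ψ̄ = (ε₄ + a) + B₀C_D(ε₄ + a)²`. [folklore] -/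
theorem hAN_of_readOuts_linearization {W : Set E} {Pu : Finset (Plaq P j)} {Λu : Finset (PBond P j)}
    (hcov : ∀ p ∈ Pu, ∀ bo ∈ plaqOBonds p, bo.1 ∈ Λu) (hol : Plaq P j → E → A)
    {Rad ε₄ a κ : ℝ} (Xs 𝔄f : E → ℂ → 𝒴)
    (hXd : ∀ x ∈ W, DifferentiableOn ℂ (Xs x) (ball 0 Rad)) (h𝔄d : ∀ x ∈ W, DifferentiableOn ℂ (𝔄f x) (ball 0 Rad))
    (hXb : ∀ x ∈ W, ∀ σ ∈ ball (0 : ℂ) Rad, ‖Xs x σ‖ ≤ ε₄)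
    (h𝔄b : ∀ x ∈ W, ∀ σ ∈ ball (0 : ℂ) Rad, ‖𝔄f x σ‖ < a)
    (hX0 : ∀ x ∈ W, Xs x 0 = 0) (h𝔄0 : ∀ x ∈ W, 𝔄f x 0 = 0) (hεa : 0 < ε₄ + a)
    -- the linearization data (46) + (55)/Prop. 3
    (H : 𝒟 →L[ℂ] 𝒴) {B₀ : ℝ} (hH : ∀ B, ‖H B‖ ≤ B₀ * ‖B‖) (hB₀ : 0 ≤ B₀) {D : 𝒴 → 𝒟} {C : ℝ} (hC : 0 ≤ C)
    (hDd : DifferentiableOn ℂ D (ball 0 (ε₄ + a))) (hD : ∀ Y ∈ ball (0 : 𝒴) (ε₄ + a), ‖D Y‖ ≤ C * ‖Y‖ ^ 2)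
    -- read-outs and the four-letter holonomy dictionary
    (ℓ : PBond P j → (𝒴 →L[ℂ] A)) (hκ : 0 ≤ κ) (hℓ : ∀ b ∈ Λu, ∀ Y, ‖ℓ b Y‖ ≤ κ * ‖Y‖)
    (hhol : ∀ x ∈ W, ∀ p ∈ Pu, ∀ c : ℝ, 0 ≤ c → c ≤ 1 →
      hol p (c • x) =
        exp (ℓ ⟨p.src, p.μ⟩ ((Xs x c + 𝔄f x c) - H (D (Xs x c + 𝔄f x c)))) *
        exp (ℓ ⟨p.src.shift p.μ, p.ν⟩ ((Xs x c + 𝔄f x c) - H (D (Xs x c + 𝔄f x c)))) *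
        exp (-(ℓ ⟨p.src.shift p.ν, p.μ⟩ ((Xs x c + 𝔄f x c) - H (D (Xs x c + 𝔄f x c))))) *
        exp (-(ℓ ⟨p.src, p.ν⟩ ((Xs x c + 𝔄f x c) - H (D (Xs x c + 𝔄f x c)))))) :
    ∀ x ∈ W, ∀ p ∈ Pu, ∃ f : ℂ → A, DifferentiableOn ℂ f (ball 0 Rad) ∧
      (∀ w ∈ ball (0 : ℂ) Rad, ‖f w‖ ≤ Real.exp (4 * (κ * ((ε₄ + a) + B₀ * C * (ε₄ + a) ^ 2))) - 1) ∧ f 0 = 0 ∧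
      ∀ c : ℝ, 0 ≤ c → c ≤ 1 → f (c : ℂ) = hol p (c • x) - 1 := by
  obtain ⟨hΨd, hΨ0, hΨb⟩ := landau_binders H hH hB₀ hC hεa hDd hD
  exact hAN_of_readOuts hcov hol Xs 𝔄f (fun Y => Y - H (D Y)) hXd h𝔄d hXb h𝔄b hX0 h𝔄0 hΨd hΨ0 hΨb ℓ hκ hℓ hhol

/-! ## §2 Road 2: S4's `hAN_of_blockBondData` on the read-outs of the kernel Landau rays -/

omit [NormedAddCommGroup 𝒟] [NormedSpace ℂ 𝒟] in
/-- **END-II's `hAN` FOR A BLOCK, ROAD 2** — `ShellMeasureBlockWiring.hAN_of_blockBondData` (leaf-07) on the bond family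
`X x b σ := ℓ_b (Y_x σ − H (D_x σ))`: per window point `x ∈ W` a holomorphic curve `Y_x` on the disc (`‖Y_x σ‖ < ε`,
`Y_x 0 = 0`) and its Landau correction `D_x` (holomorphic, `‖D_x σ‖ ≤ 4C₂ε²`, `D_x 0 = 0`) — the ∃-output of
`ShellMeasureLandauFixedPoint.landauCorrection_along` / `landauCorrection_zero`, destructured —, the operator `H` with
(46)-TYPE bound `B₀`, read-outs `ℓ_b` (`‖ℓ_b Y‖ ≤ κ‖Y‖` on `Λu`) and the four-letter holonomy dictionary for the Landau
exponent `Y_x c − H (D_x c)`.  CONCLUSION: E2′'s `hAN` with `H_AN = e^{4κ(ε + 4C₂B₀ε²)} − 1` ((an)+(fl) per bond by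
`bondFn_landau_along`). [folklore] -/
theorem hAN_of_landauRays {W : Set E} {Pu : Finset (Plaq P j)} {Λu : Finset (PBond P j)}
    (hcov : ∀ p ∈ Pu, ∀ bo ∈ plaqOBonds p, bo.1 ∈ Λu) (hol : Plaq P j → E → A)
    (H : 𝒳 →L[ℂ] 𝒴) {B₀ : ℝ} (hB₀ : 0 ≤ B₀) (hH : ∀ X, ‖H X‖ ≤ B₀ * ‖X‖)
    {C₂ ε Rad κ : ℝ} (Y : E → ℂ → 𝒴) (Dc : E → ℂ → 𝒳)
    (hYd : ∀ x ∈ W, DifferentiableOn ℂ (Y x) (ball 0 Rad)) (hY : ∀ x ∈ W, ∀ σ ∈ ball (0 : ℂ) Rad, ‖Y x σ‖ < ε)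
    (hY0 : ∀ x ∈ W, Y x 0 = 0) (hDd : ∀ x ∈ W, DifferentiableOn ℂ (Dc x) (ball 0 Rad))
    (hDb : ∀ x ∈ W, ∀ σ ∈ ball (0 : ℂ) Rad, ‖Dc x σ‖ ≤ 4 * C₂ * ε ^ 2) (hD0 : ∀ x ∈ W, Dc x 0 = 0)
    (ℓ : PBond P j → (𝒴 →L[ℂ] A)) (hκ : 0 ≤ κ) (hℓ : ∀ b ∈ Λu, ∀ Z, ‖ℓ b Z‖ ≤ κ * ‖Z‖)
    (hhol : ∀ x ∈ W, ∀ p ∈ Pu, ∀ c : ℝ, 0 ≤ c → c ≤ 1 →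
      hol p (c • x) =
        exp (ℓ ⟨p.src, p.μ⟩ (Y x c - H (Dc x c))) * exp (ℓ ⟨p.src.shift p.μ, p.ν⟩ (Y x c - H (Dc x c))) *
        exp (-(ℓ ⟨p.src.shift p.ν, p.μ⟩ (Y x c - H (Dc x c)))) * exp (-(ℓ ⟨p.src, p.ν⟩ (Y x c - H (Dc x c))))) :
    ∀ x ∈ W, ∀ p ∈ Pu, ∃ f : ℂ → A, DifferentiableOn ℂ f (ball 0 Rad) ∧
      (∀ w ∈ ball (0 : ℂ) Rad, ‖f w‖ ≤ Real.exp (4 * (κ * (ε + B₀ * (4 * C₂ * ε ^ 2)))) - 1) ∧ f 0 = 0 ∧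
      ∀ c : ℝ, 0 ≤ c → c ≤ 1 → f (c : ℂ) = hol p (c • x) - 1 :=
  hAN_of_blockBondData hcov hol (fun x b σ => ℓ b (Y x σ - H (Dc x σ)))
    (fun x hx b hb => bondFn_landau_along H hB₀ hH (hYd x hx) (hY x hx) (hY0 x hx) (hDd x hx) (hDb x hx) (hD0 x hx)
      (ℓ b) hκ (hℓ b hb))
    hhol

end Summit.QuantumFields.BalabanUV.T4Continuum.ShellMeasureBlockWiringLandau
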